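import Literature.NumberTheory.GaloisRepresentations.LocalBaseChange
import Literature.NumberTheory.GaloisRepresentations.WeilGroupRestrictProofs
import Mathlib.NumberTheory.NumberField.Completion.FinitePlace
import HarnessLib

/-!
# Local base change at a pair of places `w ∣ v`: the completions `K_v ⊆ L_w` as an extension of local fields

Topic `NumberTheory/GaloisRepresentations`. Proof file (theorems only: no definition, no named fact,
no instance) next to `LocalBaseChange` (`IsLocalBaseChangeAt K L v w 𝓛v 𝓛w πv πw`, the local base
change predicate of Arthur–Clozel, Ch. 3 §1, Def. 1.2 — "for any `w ∣ v`, the component `Π_w` is a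
lift of `π_v`" — through the local Langlands correspondence, Getz–Hahn §13.5). That predicate is
stated along the tree's local base-change map `adicCompletionOfLiesOver K L v w : K_v →+* L_w`
(Cassels–Fröhlich, Ch. II §10: the canonical embedding `k_v → K_w`) and quantifies the inclusion
`res(W_{L_w}) ≤ W_{K_v}` of Weil groups conjunctively; its existence theorem `exists_isLocalBaseChangeAt`
asks in addition for the residue degree `f` with `q_w = q_v ^ f`. This file supplies that number-field
plumbing once and for all, so that consumers see hypothesis-free statements:

* §1 `K_v ⊆ L_w` IS a finite extension of non-archimedean local fields with compatible valuations:
  `continuousSMul_adicCompletionOfLiesOver` (with the scalar tower `K → K_v → L_w` of the tree's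
  `isScalarTower_adicCompletionOfLiesOver`, re-proved privately here),
  **`finiteDimensional_adicCompletionOfLiesOver`** (Mathlib: `K_v ⊗_K L → L_w` has dense, closed range —
  Cassels–Fröhlich II §10, `[L_w : K_v] ≤ [L : K]`), **`valuativeExtension_adicCompletionOfLiesOver`**
  (automatic continuity of homomorphisms of local fields, the tree's
  `valuativeExtension_of_cast_residueFieldCard_eq_zero`; Serre, *Local Fields*, II §4).
* §2 the Weil-group data: **`weilSubgroup_map_le_of_liesOver`** — `res(W_{L_w}) ≤ W_{K_v}`
  (Tate (1.4.5)–(1.4.6); the tree's discharged `WeilGroup.weilSubgroup_map_absGaloisRestrict_le_holds`),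
  and **`exists_residueFieldCard_eq_pow_of_liesOver`** — `q_w = q_v ^ f` for some `f`
  (Serre II §2; the tree's `LocalWeilDatum.residueFieldCard_eq_pow_inertiaDeg`).
* §3 consequences for `IsLocalBaseChangeAt`: `isLocalBaseChangeAt_iff_of_liesOver` (unfolding at THE
  inclusion of §2), `IsLocalBaseChangeAt.isLocalBaseChangeAlong`, and
  **`exists_isLocalBaseChangeAt_of_liesOver`** — every irreducible smooth `πv` of `GL_n(K_v)` has a
  local base change to `GL_n(L_w)` for every `w ∣ v`, granted only the continuity of the restriction
  map of Weil groups `W_{L_w} → W_{K_v}` (the tree's theorem `WeilGroup.continuous_map_of_le`, file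
  `WeilGroupMapContinuousProofs`, equivalently the named fact `WeilGroup.continuous_map K_v L_w`
  discharged there; kept as the hypothesis `hc` exactly as in `WeilDeligneRep.restrictAlong`).

Everything PROVED (0 named facts, 0 `sorry`); no `instance` is declared (the `K_v`-algebra structure
on `L_w` is the term `(adicCompletionOfLiesOver K L v w).toAlgebra` under `letI`, the tree's convention
of `ToLocalRestrictField`, `LocalConditionPushdown`, `UnipotentInertiaOpenSubgroup`).

## References

* [ArthurClozel1989] J. Arthur, L. Clozel, *Simple algebras, base change, and the advanced theory of
  the trace formula*, Ann. of Math. Stud. 120 (1989), Ch. 3 §1, Def. 1.2; Ch. 1, Thm. 6.2 (a).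
* [CasselsFrohlichANT1967] J. W. S. Cassels, A. Fröhlich (eds.), *Algebraic Number Theory* (1967),
  Ch. II §10.
* [SerreLocalFields1979] J.-P. Serre, *Local Fields*, GTM 67 (1979), Ch. II §2, §4.
* [TateCorvallis1979] J. Tate, *Number theoretic background*, Corvallis 1979, (1.4.5)–(1.4.6).
* [HarrisTaylorAMS2001] M. Harris, R. Taylor, Ann. of Math. Stud. 151 (2001), Thm. A.
-/

noncomputable section

open scoped MatrixGroups

namespace Literature.NumberTheory.GaloisRepresentations

open NumberField IsDedekindDomain Literature.NumberTheory.Automorphic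
open GaloisRepresentations.IsNonarchimedeanLocalField

variable (K L : Type) [Field K] [NumberField K] [Field L] [NumberField L] [Algebra K L]
  (v : HeightOneSpectrum (𝓞 K)) (w : HeightOneSpectrum (𝓞 L)) [w.asIdeal.LiesOver v.asIdeal]

/-! ### §1 `K_v ⊆ L_w` is a finite extension of local fields with compatible valuations -/

/-- `K → K_v → L_w` is a scalar tower for `adicCompletionOfLiesOver K L v w : K_v →+* L_w` (it
extends `K → L`, `adicCompletionOfLiesOver_coe`) — a private local copy of the tree's
`isScalarTower_adicCompletionOfLiesOver` (`ToLocalRestrictField`, not imported here to keep this file's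
import cone inside `NumberTheory/Automorphic` + `GaloisRepresentations/WeilGroup*`).
[cite: CasselsFrohlichANT1967, Ch. II §10] -/
private theorem isScalarTower_ofLiesOver_aux :
    letI := (adicCompletionOfLiesOver K L v w).toAlgebra
    IsScalarTower K (v.adicCompletion K) (w.adicCompletion L) := by
  letI := (adicCompletionOfLiesOver K L v w).toAlgebra
  refine IsScalarTower.of_algebraMap_eq fun x => ?_
  rw [RingHom.algebraMap_toAlgebra]
  change ((algebraMap K L x : L) : w.adicCompletion L) =
    adicCompletionOfLiesOver K L v w ((algebraMap K K x : K) : v.adicCompletion K)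
  rw [adicCompletionOfLiesOver_coe]
  rfl

/-- The `K_v`-action on `L_w` through `adicCompletionOfLiesOver` is continuous
(`continuous_adicCompletionOfLiesOver`). [cite: CasselsFrohlichANT1967, Ch. II §10] -/
theorem continuousSMul_adicCompletionOfLiesOver :
    letI := (adicCompletionOfLiesOver K L v w).toAlgebra
    ContinuousSMul (v.adicCompletion K) (w.adicCompletion L) := by
  letI := (adicCompletionOfLiesOver K L v w).toAlgebra
  exact ⟨((continuous_adicCompletionOfLiesOver K L v w).comp continuous_fst).mul continuous_snd⟩

/-- **`L_w` is finite over `K_v`** (for the local base-change map `adicCompletionOfLiesOver`): the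
multiplication map `K_v ⊗_K L → L_w` has dense range containing `L` and finite-dimensional, hence
closed, range, so it is onto (Mathlib's instance `Module.Finite K_v L_w` for any continuous
`K_v`-algebra structure on `L_w` compatible with `K → L`); in particular `[L_w : K_v] ≤ [L : K]`.
[cite: CasselsFrohlichANT1967, Ch. II §10] -/
theorem finiteDimensional_adicCompletionOfLiesOver :
    letI := (adicCompletionOfLiesOver K L v w).toAlgebra
    FiniteDimensional (v.adicCompletion K) (w.adicCompletion L) := by
  letI := (adicCompletionOfLiesOver K L v w).toAlgebra
  haveI := isScalarTower_ofLiesOver_aux K L v w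
  haveI := continuousSMul_adicCompletionOfLiesOver K L v w
  infer_instance

/-- **Compatible valuations**: the `K_v`-algebra structure of `L_w` is a valuative extension — a
homomorphism between non-archimedean local fields is automatically an embedding of valued fields
(the tree's `valuativeExtension_of_cast_residueFieldCard_eq_zero` with
`cast_residueFieldCard_eq_zero_of_algebra`). [cite: SerreLocalFields1979, Ch. II §4] -/
theorem valuativeExtension_adicCompletionOfLiesOver :
    letI := (adicCompletionOfLiesOver K L v w).toAlgebra
    ValuativeExtension (v.adicCompletion K) (w.adicCompletion L) := by
  letI := (adicCompletionOfLiesOver K L v w).toAlgebra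
  exact valuativeExtension_of_cast_residueFieldCard_eq_zero cast_residueFieldCard_eq_zero_of_algebra

/-! ### §2 Weil-group data of `L_w / K_v` -/

/-- **`res(W_{L_w}) ≤ W_{K_v}`**: the restriction `Gal(L̄_w/L_w) → Gal(K̄_v/K_v)` along
`adicCompletionOfLiesOver` maps the Weil group into the Weil group (Tate: `W_E = G_E ∩ W_F`; the tree's
discharged `WeilGroup.weilSubgroup_map_absGaloisRestrict_le_holds`, fed by §1). This is the argument
`h` of `WeilGroup.map K_v L_w h`, `WeilDeligneRep.IsRestrictionAlong h`, `IsLocalBaseChangeAlong 𝓛v 𝓛w h`.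
[cite: TateCorvallis1979, (1.4.5)–(1.4.6)] -/
theorem weilSubgroup_map_le_of_liesOver :
    letI := (adicCompletionOfLiesOver K L v w).toAlgebra
    (weilSubgroup (w.adicCompletion L)).map
        (absGaloisRestrict (v.adicCompletion K) (w.adicCompletion L)).toMonoidHom ≤
      weilSubgroup (v.adicCompletion K) := by
  letI := (adicCompletionOfLiesOver K L v w).toAlgebra
  haveI := finiteDimensional_adicCompletionOfLiesOver K L v w
  haveI := valuativeExtension_adicCompletionOfLiesOver K L v w
  exact WeilGroup.weilSubgroup_map_absGaloisRestrict_le_holds (v.adicCompletion K) (w.adicCompletion L)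

/-- **Residue degree**: `q_w = q_v ^ f` for some `f` (the residue field of `L_w` is a finite extension
of that of `K_v`; the tree's `LocalWeilDatum.residueFieldCard_eq_pow_inertiaDeg`, fed by §1).
[cite: SerreLocalFields1979, Ch. II §2] -/
theorem exists_residueFieldCard_eq_pow_of_liesOver :
    ∃ f : ℕ, residueFieldCard (w.adicCompletion L) = residueFieldCard (v.adicCompletion K) ^ f := by
  letI := (adicCompletionOfLiesOver K L v w).toAlgebra
  haveI := finiteDimensional_adicCompletionOfLiesOver K L v w
  haveI := valuativeExtension_adicCompletionOfLiesOver K L v w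
  exact ⟨_, LocalWeilDatum.residueFieldCard_eq_pow_inertiaDeg (v.adicCompletion K) (w.adicCompletion L)⟩

/-! ### §3 Consequences for `IsLocalBaseChangeAt` -/

variable {K L}

/-- `IsLocalBaseChangeAt` unfolded at THE inclusion `weilSubgroup_map_le_of_liesOver` (proof
irrelevance: any inclusion witness gives the same predicate). [cite: ArthurClozel1989, Ch. 3 §1 Def. 1.2] -/
theorem isLocalBaseChangeAt_iff_of_liesOver {𝓛v : LocalLanglandsDatum (v.adicCompletion K)}
    {𝓛w : LocalLanglandsDatum (w.adicCompletion L)} {n : ℕ}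
    {πv : SmoothIrrep (GL (Fin n) (v.adicCompletion K))}
    {πw : SmoothIrrep (GL (Fin n) (w.adicCompletion L))} :
    IsLocalBaseChangeAt K L v w 𝓛v 𝓛w πv πw ↔
      (letI := (adicCompletionOfLiesOver K L v w).toAlgebra
       IsLocalBaseChangeAlong 𝓛v 𝓛w (weilSubgroup_map_le_of_liesOver K L v w) πv πw) :=
  isLocalBaseChangeAt_iff (weilSubgroup_map_le_of_liesOver K L v w)

/-- From `IsLocalBaseChangeAt` to `IsLocalBaseChangeAlong` at THE inclusion.
[cite: ArthurClozel1989, Ch. 3 §1 Def. 1.2] -/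
theorem IsLocalBaseChangeAt.isLocalBaseChangeAlong {𝓛v : LocalLanglandsDatum (v.adicCompletion K)}
    {𝓛w : LocalLanglandsDatum (w.adicCompletion L)} {n : ℕ}
    {πv : SmoothIrrep (GL (Fin n) (v.adicCompletion K))}
    {πw : SmoothIrrep (GL (Fin n) (w.adicCompletion L))} (H : IsLocalBaseChangeAt K L v w 𝓛v 𝓛w πv πw) :
    letI := (adicCompletionOfLiesOver K L v w).toAlgebra
    IsLocalBaseChangeAlong 𝓛v 𝓛w (weilSubgroup_map_le_of_liesOver K L v w) πv πw :=
  (isLocalBaseChangeAt_iff_of_liesOver v w).mp H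

/-- **Existence of local base change at `w ∣ v`**, hypothesis-free but for the continuity of the
restriction map of Weil groups `W_{L_w} → W_{K_v}` (`hc`; the tree's `WeilGroup.continuous_map_of_le`):
every irreducible smooth `πv` of `GL_n(K_v)` has a local base change `πw` to `GL_n(L_w)`, i.e.
`rec_w(πw) ≅ rec_v(πv)|_{W_{L_w}}` (`exists_isLocalBaseChangeAt` with §2's inclusion and residue degree).
[cite: ArthurClozel1989, Ch. 1 Thm. 6.2 (a)] [cite: HarrisTaylorAMS2001, Thm. A] -/
theorem exists_isLocalBaseChangeAt_of_liesOver (𝓛v : LocalLanglandsDatum (v.adicCompletion K))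
    (𝓛w : LocalLanglandsDatum (w.adicCompletion L)) {n : ℕ}
    (hc : letI := (adicCompletionOfLiesOver K L v w).toAlgebra
      Continuous (WeilGroup.map (v.adicCompletion K) (w.adicCompletion L)
        (weilSubgroup_map_le_of_liesOver K L v w)))
    (πv : SmoothIrrep (GL (Fin n) (v.adicCompletion K))) :
    ∃ πw : SmoothIrrep (GL (Fin n) (w.adicCompletion L)), IsLocalBaseChangeAt K L v w 𝓛v 𝓛w πv πw := by
  obtain ⟨f, hf⟩ := exists_residueFieldCard_eq_pow_of_liesOver K L v w
  exact exists_isLocalBaseChangeAt 𝓛v 𝓛w (weilSubgroup_map_le_of_liesOver K L v w) hc f hf πv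

/-- The same, with the continuity supplied by the NAMED FACT `WeilGroup.continuous_map K_v L_w`
(Tate (1.4.5)–(1.4.6); discharged in the tree as `WeilGroup.continuous_map_holds`), whose instance
arguments are §1's finiteness and valuative-extension theorems.
[cite: ArthurClozel1989, Ch. 1 Thm. 6.2 (a)] [cite: TateCorvallis1979, (1.4.5)–(1.4.6)] -/
theorem exists_isLocalBaseChangeAt_of_continuous_map (𝓛v : LocalLanglandsDatum (v.adicCompletion K))
    (𝓛w : LocalLanglandsDatum (w.adicCompletion L)) {n : ℕ}
    (hcont : letI := (adicCompletionOfLiesOver K L v w).toAlgebra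
      haveI := finiteDimensional_adicCompletionOfLiesOver K L v w
      haveI := valuativeExtension_adicCompletionOfLiesOver K L v w
      WeilGroup.continuous_map (v.adicCompletion K) (w.adicCompletion L))
    (πv : SmoothIrrep (GL (Fin n) (v.adicCompletion K))) :
    ∃ πw : SmoothIrrep (GL (Fin n) (w.adicCompletion L)), IsLocalBaseChangeAt K L v w 𝓛v 𝓛w πv πw :=
  exists_isLocalBaseChangeAt_of_liesOver v w 𝓛v 𝓛w (hcont _) πv

/-- **Uniqueness and existence together**: for `w ∣ v` and local Langlands data at both completions,
local base change is a well-defined map on isomorphism classes `Irr(GL_n(K_v)) → Irr(GL_n(L_w))`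
(existence from `hc`, uniqueness `IsLocalBaseChangeAt.irrClass_eq`).
[cite: ArthurClozel1989, Ch. 1 Thm. 6.2 (a)] [cite: HarrisTaylorAMS2001, Thm. A] -/
theorem existsUnique_irrClass_isLocalBaseChangeAt (𝓛v : LocalLanglandsDatum (v.adicCompletion K))
    (𝓛w : LocalLanglandsDatum (w.adicCompletion L)) {n : ℕ}
    (hc : letI := (adicCompletionOfLiesOver K L v w).toAlgebra
      Continuous (WeilGroup.map (v.adicCompletion K) (w.adicCompletion L)
        (weilSubgroup_map_le_of_liesOver K L v w)))
    (πv : SmoothIrrep (GL (Fin n) (v.adicCompletion K))) :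
    ∃! c : IrrClass (GL (Fin n) (w.adicCompletion L)),
      ∃ πw : SmoothIrrep (GL (Fin n) (w.adicCompletion L)),
        IrrClass.mk πw = c ∧ IsLocalBaseChangeAt K L v w 𝓛v 𝓛w πv πw := by
  obtain ⟨πw, H⟩ := exists_isLocalBaseChangeAt_of_liesOver v w 𝓛v 𝓛w hc πv
  refine ⟨IrrClass.mk πw, ⟨πw, rfl, H⟩, ?_⟩
  rintro c ⟨πw', rfl, H'⟩
  exact H'.irrClass_eq H

end Literature.NumberTheory.GaloisRepresentations

end
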